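import Summits.NavierStokesRegularity.NavierStokesRegularity.Theses.AxisymmetricExtremality
import Literature.Analysis.FluidPDE.RusinSverakSingularPoint
import Literature.Analysis.FluidPDE.RusinSverakSingularPointProofs
import Literature.Analysis.FluidPDE.KatoMaximalTimeSingular
import Literature.Analysis.FluidPDE.KatoFarFieldBound
import Literature.Analysis.FluidPDE.KatoLocalHolds
import Literature.Analysis.FluidPDE.MildL3SmoothHolds
import Literature.Analysis.FluidPDE.KatoLocalL3Exists
import Literature.Analysis.FluidPDE.BoundedRepresentative
import Literature.Analysis.FluidPDE.AxisymmetricHeatFlow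
import Literature.Analysis.FluidPDE.BoundedWeakIsometry
import Literature.Analysis.FluidPDE.TaoClassSymmetry
import HarnessLib

/-!
# `AxisymmetricKatoGlobal` (stmt-NavierStokesRegularity-15453), line `registered`:
# stub `stub_katoAxisymSingularPoint` — Kato's `L³` theory in the axisymmetric class

Step 1 of the line: if an axisymmetric, weakly divergence-free `u₀ ∈ L³(ℝ³)` has NO global Kato
solution for the viscosity `ν > 0`, then for `T = T_max(u₀) ∈ (0, ∞)` there is a Kato solution
`u` on `[0, T)` (`IsKatoSolutionOn`) which is jointly smooth on the open strip `(0, T) × ℝ³`, has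
axisymmetric slices for `0 < t < T`, and has a singular point `(T, x_*)`:
`‖u‖_{L^∞(Q_r(T, x_*))} = ∞` for every `r > 0` (Kato 1984, Thms 1–4; Lemarié-Rieusset 2016,
Thm. 15.1 (C); Rusin–Šverák, arXiv:0911.0500, §3–§4).

Proof.
* The tree's `exists_singularPoint_katoMaximalTime` (from the discharged named facts
  `kato_local_holds`, `IsKatoSolutionOn.continuation_of_bounded_holds`,
  `IsKatoSolutionOn.farField_bound_holds`) gives the maximal Kato solution `u` on `[0, T_max)`
  with a singular point `(T_max, x_*)`.
* `IsKatoSolutionOn.exists_isSmoothSpaceTimeOn_ae_eq mild_L3_smooth_holds` gives a field `w`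
  jointly smooth on the open strip with `u t = w t` a.e. for every `t ∈ (0, T)`; the modification
  `u' t = w t` for `t ∈ (0, T)`, `u' t = u t` otherwise, is again a Kato solution from `u₀` (the
  class only sees the a.e. classes of the slices: `IsMildNSSolutionOn.congr_ae_Ico`,
  `ContinuousInLpOn.congr_ae_slices`; measurability on the strip from continuity of `w`), it is
  smooth on the strip, and the singularity transfers along the a.e. equality on the strip
  (`ae_restrict_prod_of_forall_ae_eq`, `eLpNorm_parabolicCylinder_eq_top_of_ae_eq`).
* AXISYMMETRY of `w t`: **rotation covariance of Kato solutions** — for a linear isometry `R`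
  of `ℝ³`, `(t, x) ↦ R (u t (R⁻¹ x))` is a Kato solution from `R ∘ u₀ ∘ R⁻¹` (the duality
  identity is tested against `R⁻¹ φ(R ·)`; the heat flow, the convective derivative, weak
  divergence-freeness, `C([0,T); L³)` and strip measurability are all `O(3)`-covariant:
  `heatExtension_comp_linearIsometryEquiv`, `convect_conj_linearIsometryEquiv`,
  `IsWeaklyDivFree.conj_linearIsometryEquiv`, `LinearIsometryEquiv.measurePreserving`).  For
  `R = R_θ` (`rotZLIE θ`) and axisymmetric `u₀` the rotated datum is `u₀` itself, so Kato
  uniqueness (`kato_unique_holds`, via `IsKatoSolutionOn.ae_eq`) gives `u t = R_θ u t R_θ⁻¹`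
  a.e.; transporting through `u t = w t` a.e. and the measure-preserving rotation,
  `w t = R_θ w t R_θ⁻¹` a.e., hence everywhere since both sides are continuous
  (`Continuous.ae_eq_iff_eq`) — i.e. `IsAxisymmetric (w t)` (Majda–Bertozzi 2002, §1.2
  Prop. 1.1 (iii) and §2.3.3; KNSS 2009, §1).
-/

noncomputable section

-- the summit and its single problem share the name (D-0017 nested layout)
set_option linter.dupNamespace false

open Set MeasureTheory Filter Topology Function Metric TopologicalSpace
open scoped ENNReal NNReal InnerProductSpace RealInnerProductSpace
open Literature.Analysis.FluidPDE Literature.Analysis.FunctionSpaces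

namespace Summit.NavierStokesRegularity.NavierStokesRegularity.Theorems.AxisymmetricKatoGlobal.Registered

/-- Local notation for physical space `ℝ³` (as in the registered skeleton). -/
local notation "ℝ³" => EuclideanSpace ℝ (Fin 3)

/-! ### Rotation covariance of the duality identity and of Kato's class -/

section Covariance

variable {E : Type*} [NormedAddCommGroup E] [InnerProductSpace ℝ E] [FiniteDimensional ℝ E]
  [MeasurableSpace E] [BorelSpace E]

omit [FiniteDimensional ℝ E] [MeasurableSpace E] [BorelSpace E] in
/-- A test field on the whole space conjugated by a linear isometry, `x ↦ R (φ (R⁻¹ x))`, is a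
test field on the whole space (Evans, *PDE*, §5.2.1). [folklore] -/
theorem isTestFunctionOn_conj_linearIsometryEquiv (R : E ≃ₗᵢ[ℝ] E) {φ : E → E}
    (hφ : IsTestFunctionOn (⊤ : Opens E) φ) :
    IsTestFunctionOn (⊤ : Opens E) (fun x => R (φ (R.symm x))) := by
  have heq : (fun x => R (φ (R.symm x))) =
      (R : E → E) ∘ (φ ∘ (R.symm.toContinuousLinearEquiv.toHomeomorph : E → E)) := by
    funext x; rfl
  refine ⟨?_, ?_, by simp⟩
  · exact R.toContinuousLinearEquiv.contDiff.comp
      (hφ.contDiff.comp R.symm.toContinuousLinearEquiv.contDiff)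
  · rw [heq]
    exact (hφ.hasCompactSupport.comp_homeomorph _).comp_left (map_zero R)

/-- Change of variables by the inverse of a linear isometry in a Bochner integral:
`∫ g (R⁻¹ x) dx = ∫ g y dy` (Lebesgue measure is `O(E)`-invariant). [folklore] -/
theorem integral_comp_linearIsometryEquiv_symm {G : Type*} [NormedAddCommGroup G]
    [NormedSpace ℝ G] (R : E ≃ₗᵢ[ℝ] E) (g : E → G) : ∫ x, g (R.symm x) = ∫ y, g y :=
  R.symm.measurePreserving.integral_comp R.symm.toHomeomorph.measurableEmbedding g

/-- **Conjugated pairings**: `∫ ⟪R U(R⁻¹ x), Φ(x)⟫ dx = ∫ ⟪U(y), R⁻¹ Φ(R y)⟫ dy`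
(`⟪R a, b⟫ = ⟪a, R⁻¹ b⟫` and the change of variables `x = R y`). [folklore] -/
theorem integral_inner_conj_linearIsometryEquiv (R : E ≃ₗᵢ[ℝ] E) (U Φ : E → E) :
    ∫ x, ⟪R (U (R.symm x)), Φ x⟫ = ∫ y, ⟪U y, R.symm (Φ (R y))⟫ := by
  rw [← integral_comp_linearIsometryEquiv_symm R (fun y => ⟪U y, R.symm (Φ (R y))⟫)]
  refine integral_congr_ae (Eventually.of_forall fun x => ?_)
  simp only [LinearIsometryEquiv.apply_symm_apply, LinearIsometryEquiv.inner_map_eq_flip]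

/-- **The heat flow is `O(E)`-covariant**: `e^{τΔ}(R φ(R⁻¹ ·))(x) = R (e^{τΔ}φ)(R⁻¹ x)` for
every `τ` (for `τ ≤ 0` both sides are the documented junk/identity value; for `τ > 0` the heat
kernel is radial and `R` preserves Lebesgue measure: `heatExtension_comp_linearIsometryEquiv`,
`heatExtension_continuousLinearEquiv_comp`). [folklore] -/
theorem heatFlow_conj_linearIsometryEquiv (R : E ≃ₗᵢ[ℝ] E) (φ : E → E) (τ : ℝ) (x : E) :
    heatFlow (fun y => R (φ (R.symm y))) τ x = R (heatFlow φ τ (R.symm x)) := by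
  rcases le_or_gt τ 0 with hτ | hτ
  · rw [heatFlow_of_nonpos _ hτ, heatFlow_of_nonpos _ hτ]
  · rw [heatFlow_of_pos _ hτ, heatFlow_of_pos _ hτ]
    have h1 : (fun y => R (φ (R.symm y))) =
        fun y => R.toContinuousLinearEquiv ((fun z => φ (R.symm z)) y) := rfl
    rw [h1, heatExtension_continuousLinearEquiv_comp, heatExtension_comp_linearIsometryEquiv]
    rfl

/-- The caloric test field is `O(E)`-covariant:
`e^{ντΔ}(R φ(R⁻¹ ·))(x) = R (e^{ντΔ}φ)(R⁻¹ x)` (Fabes–Jones–Rivière 1972, §2). [folklore] -/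
theorem heatTest_conj_linearIsometryEquiv (R : E ≃ₗᵢ[ℝ] E) (ν : ℝ) (φ : E → E) (τ : ℝ) (x : E) :
    heatTest ν (fun y => R (φ (R.symm y))) τ x = R (heatTest ν φ τ (R.symm x)) :=
  heatFlow_conj_linearIsometryEquiv R φ (ν * τ) x

/-- **Rotation covariance of the unforced duality identity from the datum**
(Fabes–Jones–Rivière 1972, Thm. 2.1; Majda–Bertozzi 2002, §1.2 Prop. 1.1 (iii)): if the
identity holds for `u` from `u₀` at time `t`, it holds for the conjugate `(τ, x) ↦ R (u τ (R⁻¹ x))`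
from `R ∘ u₀ ∘ R⁻¹` — test `u` against `ψ = R⁻¹ φ(R ·)`; then `e^{νsΔ}φ = R (e^{νsΔ}ψ)(R⁻¹ ·)`,
the convective derivative is covariant (`convect_conj_linearIsometryEquiv`), and the three
pairings match after the change of variables `x = R y`.
[cite: MajdaBertozziCUP2002, §1.2 Prop. 1.1 (iii)] -/
theorem isMildNSSolutionFrom_conj_linearIsometryEquiv (R : E ≃ₗᵢ[ℝ] E) {ν : ℝ} {u₀ : E → E}
    {u : ℝ → E → E} {t : ℝ} (h : IsMildNSSolutionFrom ν 0 u₀ u t) :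
    IsMildNSSolutionFrom ν 0 (fun x => R (u₀ (R.symm x))) (fun τ x => R (u τ (R.symm x))) t := by
  intro φ hφ hdiv
  set ψ : E → E := fun x => R.symm (φ (R x)) with hψ_def
  have hψ : IsTestFunctionOn (⊤ : Opens E) ψ := by
    simpa using isTestFunctionOn_conj_linearIsometryEquiv R.symm hφ
  have hψdiv : VectorCalculus.IsDivFree ψ := by
    simpa using hdiv.conj_linearIsometryEquiv R.symm
  have key := h ψ hψ hψdiv
  simp only [Pi.zero_apply, inner_zero_left, integral_zero, intervalIntegral.integral_zero,
    add_zero] at key ⊢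
  -- `φ` is the conjugate of `ψ`, so every caloric test field of `φ` is a conjugate
  have hφψ : φ = fun y => R (ψ (R.symm y)) := by
    funext y; simp [hψ_def]
  have hW : ∀ s : ℝ, heatTest ν φ s = fun x => R (heatTest ν ψ s (R.symm x)) := by
    intro s
    funext x
    conv_lhs => rw [hφψ]
    exact heatTest_conj_linearIsometryEquiv R ν ψ s x
  -- left-hand side
  have e1 : ∫ x, ⟪R (u t (R.symm x)), φ x⟫ = ∫ y, ⟪u t y, ψ y⟫ :=
    integral_inner_conj_linearIsometryEquiv R _ _
  -- datum term
  have e2 : ∫ x, ⟪R (u₀ (R.symm x)), heatTest ν φ t x⟫ = ∫ y, ⟪u₀ y, heatTest ν ψ t y⟫ := by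
    rw [integral_inner_conj_linearIsometryEquiv, hW t]
    simp
  -- nonlinear term, slice by slice
  have e3 : ∀ τ, ∫ x, ⟪R (u τ (R.symm x)),
      convect (fun x => R (u τ (R.symm x))) (heatTest ν φ (t - τ)) x⟫ =
      ∫ y, ⟪u τ y, convect (u τ) (heatTest ν ψ (t - τ)) y⟫ := by
    intro τ
    rw [hW (t - τ)]
    simp_rw [convect_conj_linearIsometryEquiv R (u τ) (heatTest ν ψ (t - τ)),
      LinearIsometryEquiv.inner_map_map]
    exact integral_comp_linearIsometryEquiv_symm R
      (fun y => ⟪u τ y, convect (u τ) (heatTest ν ψ (t - τ)) y⟫)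
  simp_rw [e3]
  rw [e1, e2, key]

/-- **Rotation covariance of mild solutions on a time set** (unforced): weak
divergence-freeness of the slices (`IsWeaklyDivFree.conj_linearIsometryEquiv`) and the duality
identity are both `O(E)`-covariant. [cite: MajdaBertozziCUP2002, §1.2 Prop. 1.1 (iii)] -/
theorem isMildNSSolutionOn_conj_linearIsometryEquiv (R : E ≃ₗᵢ[ℝ] E) {S : Set ℝ} {ν : ℝ}
    {u₀ : E → E} {u : ℝ → E → E} (h : IsMildNSSolutionOn S ν 0 u₀ u) :
    IsMildNSSolutionOn S ν 0 (fun x => R (u₀ (R.symm x))) (fun τ x => R (u τ (R.symm x))) :=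
  ⟨fun t ht => (h.1 t ht).conj_linearIsometryEquiv R,
    fun t ht => isMildNSSolutionFrom_conj_linearIsometryEquiv R (h.2 t ht)⟩

/-- `C(S; L^p)` is invariant under conjugation by a linear isometry (Lebesgue measure is
`O(E)`-invariant and `‖R v‖ = ‖v‖`; Kato 1984, §1). [folklore] -/
theorem continuousInLpOn_conj_linearIsometryEquiv (R : E ≃ₗᵢ[ℝ] E) {S : Set ℝ} {p : ℝ≥0∞}
    {u : ℝ → E → E} (h : ContinuousInLpOn S p u) :
    ContinuousInLpOn S p (fun t x => R (u t (R.symm x))) := by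
  have hmp : MeasurePreserving (R.symm : E → E) volume volume := R.symm.measurePreserving
  refine ⟨fun t ht => ?_, fun t₀ ht₀ => ?_⟩
  · have h1 : MemLp (fun x => u t (R.symm x)) p volume := (h.1 t ht).comp_measurePreserving hmp
    exact (R.toContinuousLinearEquiv : E →L[ℝ] E).comp_memLp' h1
  · refine (h.2 t₀ ht₀).congr' ?_
    filter_upwards [self_mem_nhdsWithin] with t ht
    have h1 : ((fun x => R (u t (R.symm x))) - fun x => R (u t₀ (R.symm x))) =
        fun x => R ((u t - u t₀) (R.symm x)) := by
      funext x; simp [map_sub]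
    rw [h1, eLpNorm_conj_linearIsometryEquiv R
      ((h.1 t ht).sub (h.1 t₀ ht₀)).aestronglyMeasurable]

/-- Measurability on a time strip `I × E` is invariant under conjugation by a linear isometry
(`(t, y) ↦ (t, R⁻¹ y)` preserves the restricted Lebesgue measure,
`measurePreserving_prodMap_linearIsometryEquiv_slab`). [folklore] -/
theorem aestronglyMeasurable_conj_linearIsometryEquiv_strip (R : E ≃ₗᵢ[ℝ] E) {I : Set ℝ}
    (hI : MeasurableSet I) {u : ℝ → E → E}
    (h : AEStronglyMeasurable (uncurry u) ((volume : Measure (ℝ × E)).restrict (I ×ˢ univ))) :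
    AEStronglyMeasurable (uncurry fun t x => R (u t (R.symm x)))
      ((volume : Measure (ℝ × E)).restrict (I ×ˢ univ)) := by
  have heq : uncurry (fun t y => R (u t (R.symm y))) =
      (R : E → E) ∘ uncurry u ∘ Prod.map id (R.symm : E → E) := by
    funext q; obtain ⟨t, y⟩ := q; rfl
  rw [heq]
  exact R.continuous.comp_aestronglyMeasurable (h.comp_measurePreserving
    (measurePreserving_prodMap_linearIsometryEquiv_slab R.symm I hI))

end Covariance

/-! ### Kato solutions: covariance and propagation of equivariance -/

section Kato

variable {T ν : ℝ} {u₀ : ℝ³ → ℝ³} {u : ℝ → ℝ³ → ℝ³}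

/-- **Rotation covariance of Kato solutions** (Majda–Bertozzi 2002, §1.2 Prop. 1.1 (iii), for
Kato's class `C([0,T); L³)` of mild solutions): if `u` is a Kato solution on `[0, T)` from `u₀`,
then `(t, x) ↦ R (u t (R⁻¹ x))` is a Kato solution on `[0, T)` from `R ∘ u₀ ∘ R⁻¹`, for every
linear isometry `R` of `ℝ³`. [cite: MajdaBertozziCUP2002, §1.2 Prop. 1.1 (iii)] -/
theorem isKatoSolutionOn_conj_linearIsometryEquiv (R : ℝ³ ≃ₗᵢ[ℝ] ℝ³)
    (h : IsKatoSolutionOn T ν u₀ u) :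
    IsKatoSolutionOn T ν (fun x => R (u₀ (R.symm x))) (fun t x => R (u t (R.symm x))) := by
  refine ⟨isMildNSSolutionOn_conj_linearIsometryEquiv R h.mild,
    continuousInLpOn_conj_linearIsometryEquiv R h.continuousInLpOn, ?_,
    aestronglyMeasurable_conj_linearIsometryEquiv_strip R measurableSet_Ioo
      h.aestronglyMeasurable⟩
  funext x
  simp only [h.initial]

/-- **Equivariance of the datum propagates (a.e.)**: if the datum is `R`-equivariant,
`R (u₀ (R⁻¹ x)) = u₀ x`, then at every `t ∈ [0, T)` the Kato solution agrees a.e. with its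
conjugate `R u t R⁻¹` (rotation covariance + uniqueness in Kato's class, `kato_unique_holds`;
Majda–Bertozzi 2002, §2.3.3; KNSS 2009, §1). [folklore] -/
theorem katoSolution_ae_eq_conj_of_datum (R : ℝ³ ≃ₗᵢ[ℝ] ℝ³) (hν : 0 < ν)
    (h : IsKatoSolutionOn T ν u₀ u) (hdat : (fun x => R (u₀ (R.symm x))) = u₀) {t : ℝ}
    (ht : t ∈ Ico 0 T) : u t =ᵐ[volume] fun x => R (u t (R.symm x)) := by
  have h' := isKatoSolutionOn_conj_linearIsometryEquiv R h
  rw [hdat] at h'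
  exact h.ae_eq kato_unique_holds hν h' ht.1 ht.2 ht.2

/-- **Axisymmetry propagates to the continuous representative.** If `u` is a Kato solution on
`[0, T)` from an axisymmetric datum and `w` is continuous with `u t = w` a.e. (`0 ≤ t < T`),
then `w` is axisymmetric: `w = R_θ w R_θ⁻¹` a.e. by `katoSolution_ae_eq_conj_of_datum`
transported through the measure-preserving rotation, and two continuous fields agreeing a.e.
agree everywhere. [folklore] -/
theorem katoSolution_isAxisymmetric_of_ae_eq (hν : 0 < ν) (h : IsKatoSolutionOn T ν u₀ u)
    (hax : IsAxisymmetric u₀) {t : ℝ} (ht : t ∈ Ico 0 T)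
    {w : ℝ³ → ℝ³} (hw : Continuous w)
    (hae : u t =ᵐ[volume] w) : IsAxisymmetric w := by
  intro θ x
  set R : ℝ³ ≃ₗᵢ[ℝ] ℝ³ := rotZLIE θ with hR
  have hdat : (fun x => R (u₀ (R.symm x))) = u₀ :=
    funext fun y => hax.rotZ_apply_rotZ_neg θ y
  have h1 : u t =ᵐ[volume] fun x => R (u t (R.symm x)) :=
    katoSolution_ae_eq_conj_of_datum R hν h hdat ht
  -- transport `u t = w` a.e. through the measure-preserving `R⁻¹`
  have h2 : (fun x => R (u t (R.symm x))) =ᵐ[volume] fun x => R (w (R.symm x)) := by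
    have h3 : (u t) ∘ R.symm =ᵐ[volume] w ∘ R.symm :=
      R.symm.measurePreserving.quasiMeasurePreserving.ae_eq_comp hae
    filter_upwards [h3] with x hx
    simp only [Function.comp_apply] at hx
    rw [hx]
  have h4 : w =ᵐ[volume] fun x => R (w (R.symm x)) := (hae.symm.trans h1).trans h2
  have hc : Continuous fun x => R (w (R.symm x)) :=
    R.continuous.comp (hw.comp R.symm.continuous)
  have heq : w = fun x => R (w (R.symm x)) := (Continuous.ae_eq_iff_eq volume hw hc).1 h4
  have hx := congrFun heq (rotZ θ x)
  simp only [hR, rotZLIE_apply, rotZLIE_symm_apply] at hx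
  rw [hx, ← rotZ_add, neg_add_cancel, rotZ_zero]

end Kato

/-! ### The stub -/

/-- **stub 1 — `stub_katoAxisymSingularPoint`.** Kato's `L³` theory in the axisymmetric class:
if an axisymmetric weakly divergence-free `u₀ ∈ L³(ℝ³)` has no global Kato solution for the
viscosity `ν > 0`, then for some `T > 0` (namely `T_max(u₀)`) there is a Kato solution `u` on
`[0, T)` which is jointly smooth on `(0, T) × ℝ³`, has axisymmetric slices for `0 < t < T`, and
has a singular point `(T, x_*)`: `‖u‖_{L^∞(Q_r(T, x_*))} = ∞` for every `r > 0`
(Kato 1984, Thms 1–4; Lemarié-Rieusset 2016, Thm. 15.1 (C); Rusin–Šverák, arXiv:0911.0500,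
§3 p. 5 and §4 p. 6; axisymmetry by rotation covariance + uniqueness, Majda–Bertozzi 2002,
§2.3.3). [cite: RusinSverak2011, §3 p. 5 and §4 p. 6 (arXiv:0911.0500)] -/
theorem stub_katoAxisymSingularPoint :
    ∀ ν : ℝ, 0 < ν → ∀ u₀ : ℝ³ → ℝ³, MemLp u₀ 3 volume → IsWeaklyDivFree u₀ → IsAxisymmetric u₀ →
      ¬ HasGlobalKatoSolution ν u₀ →
      ∃ T : ℝ, 0 < T ∧ ∃ (xs : ℝ³) (u : ℝ → ℝ³ → ℝ³), IsKatoSolutionOn T ν u₀ u ∧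
        ContDiffOn ℝ (⊤ : ℕ∞) (uncurry u) (Ioo 0 T ×ˢ univ) ∧
        (∀ t ∈ Ioo 0 T, IsAxisymmetric (u t)) ∧
        ∀ r : ℝ, 0 < r → eLpNorm (uncurry u) ∞ (volume.restrict (parabolicCylinder r (T, xs))) = ∞ := by
  intro ν hν u₀ h3 hdiv hax hng
  -- (a) the maximal Kato solution and its singular point
  obtain ⟨hpos, htop, xs, u, hu, hsing⟩ := exists_singularPoint_katoMaximalTime kato_local_holds
    IsKatoSolutionOn.continuation_of_bounded_holds IsKatoSolutionOn.farField_bound_holds hν h3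
    hdiv hng
  set T : ℝ := (katoMaximalTime ν u₀).toReal with hT_def
  have hT : 0 < T := ENNReal.toReal_pos hpos.ne' htop.ne
  -- (b) the smooth representative on the open strip
  obtain ⟨w, hw, hae⟩ := hu.exists_isSmoothSpaceTimeOn_ae_eq mild_L3_smooth_holds hν
  -- (c) the modified field
  set u' : ℝ → ℝ³ → ℝ³ := fun t => if t ∈ Ioo 0 T then w t else u t with hu'_def
  have hu'_in : ∀ t ∈ Ioo 0 T, u' t = w t := fun t ht => by
    simp only [hu'_def]
    exact if_pos ht
  have hu'_ae : ∀ t ∈ Ico 0 T, u' t =ᵐ[volume] u t := by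
    intro t ht
    by_cases hto : t ∈ Ioo 0 T
    · rw [hu'_in t hto]
      exact (hae t hto).symm
    · have : u' t = u t := by
        simp only [hu'_def]
        exact if_neg hto
      rw [this]
  have hstrip : IsOpen (Ioo (0 : ℝ) T ×ˢ (univ : Set ℝ³)) := isOpen_Ioo.prod isOpen_univ
  have hu'_eqOn : EqOn (uncurry u') (uncurry w) (Ioo 0 T ×ˢ univ) := by
    rintro ⟨t, x⟩ ⟨ht, -⟩
    simp [hu'_in t ht]
  have hu'_meas : AEStronglyMeasurable (uncurry u') (volume.restrict (Ioo 0 T ×ˢ univ)) := by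
    refine (hw.continuousOn.aestronglyMeasurable hstrip.measurableSet).congr ?_
    filter_upwards [ae_restrict_mem hstrip.measurableSet] with z hz
    exact (hu'_eqOn hz).symm
  have hu' : IsKatoSolutionOn T ν u₀ u' := by
    refine ⟨hu.mild.congr_ae_Ico hu'_ae EventuallyEq.rfl,
      hu.continuousInLpOn.congr_ae_slices hu'_ae, ?_, hu'_meas⟩
    have h0 : (0 : ℝ) ∉ Ioo 0 T := fun h => lt_irrefl _ h.1
    have : u' 0 = u 0 := by
      simp only [hu'_def]
      exact if_neg h0
    rw [this, hu.initial]
  refine ⟨T, hT, xs, u', hu', ?_, ?_, ?_⟩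
  · -- (e) smoothness on the open strip
    exact hw.congr hu'_eqOn
  · -- (f) axisymmetry of the smooth slices
    intro t ht
    rw [hu'_in t ht]
    exact katoSolution_isAxisymmetric_of_ae_eq hν hu hax ⟨ht.1.le, ht.2⟩
      (hw.contDiff_slice ht).continuous (hae t ht)
  · -- (d) the singularity transfers along the a.e. equality on the strip
    intro r hr
    have hae' : uncurry u' =ᵐ[volume.restrict (Ioo 0 T ×ˢ univ)] uncurry u :=
      ae_restrict_prod_of_forall_ae_eq (fun t ht => hu'_ae t ⟨ht.1.le, ht.2⟩) hu'_meas
        hu.aestronglyMeasurable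
    exact eLpNorm_parabolicCylinder_eq_top_of_ae_eq hT hae' xs hsing hr

end Summit.NavierStokesRegularity.NavierStokesRegularity.Theorems.AxisymmetricKatoGlobal.Registered

end
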